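import Mathlib

/-!
# Sketch_utd_idea_g72 — UNRAMIFIED DESCENT: the anticyclotomic layer is an unramified twist of the
# cyclotomic layer, so Kitajima–Otsuki's cyclotomic structure theorem (all odd `p`) gives BOTH signed
# structure theorems on the relative (anticyclotomic) tower at `p = 3`

utd-idea g72 (2026-08-30) · crux `stmt-BirchSwinnertonDyer-24737`
(`Summit.BirchSwinnertonDyer.BirchSwinnertonDyer.Theses.UniversalToricDescent.TwinAlgMuZeroAtThree`) ·
card `Cruxes/TwinAlgMuZeroAtThree/Ideas/one-point-squeeze.md`, residual **P⁺** (g71): «locate in print, prove,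
or refute the `+` signed structure theorem — exact annihilator `ω_m⁺`, cyclic presentation — over an
unramified base of `3`-power degree in the relative Lubin–Tate (anticyclotomic, split `𝔭`) `ℤ₃`-direction,
`a₃ = 0`».

RESOLUTION (g72, our reading; the arithmetic is in print, the algebra below is kernel-checked).
Write `𝒢 = Gal(ℚ_p^{(2)}/ℚ_p) = U × Γ ≅ ℤ_p²` (`U` unramified, `Γ` cyclotomic = inertia). The localized
anticyclotomic tower is the fixed field of `C = ℤ_p·(γ - p^a u)` (Castella–Wan, arXiv:1607.02019 §3.1,
p. 11: «`-p^a u_v + γ_v` is a topological generator»; `p^a` = unramified prefix). Its layer `F` with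
`e(F/ℚ_p) = p^m` lies in the two-variable layer `k_{m,M}` (`= ` degree-`p^m` subfield of
`k^M(μ_{p^{m+1}})`, `k^M` unramified of degree `p^M`) for every `M ≥ m + a` (ibid. §3.3 p. 12: «Noting that
`K^ac_{m,v} ⊆ k_{m,m+a}`») — `layer_le_twoVariable₁/₂` below — and `k_{m,M} = F·k^M` is UNRAMIFIED over `F`
(both have `e = p^m`), cyclic with group `H = ⟨h⟩`, `h = (u^{-p^a}, γ) ∈ U_M × Γ_m = ℤ/p^M × ℤ/p^m`.
Section `Bookkeeping` checks, for `m + a ≤ M`: `nsmul_h_eq_zero_iff` (`j•h = 0 ↔ p^{M-a} ∣ j`),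
`inertia_meets_H_trivially` (`H ∩ Γ_m = 1`, i.e. unramified), `H_acts_freely_on_unramified_index`
(the translation action of `H` on `U_M` is free). Consequently (standard, words only): the
Kitajima–Otsuki module `N^± := Ê^±(𝔪_{k_{m,M}}) ≅ ℤ_p[U_M × Γ_m]/(ω_m^±(γ-1)) = ℤ_p[U_M] ⊗ ℤ_p[Γ_m]/(ω_m^±)`
(arXiv:1607.03612 Prop. 3.22 / Rem. 3.23 with `k = k^M`, `d = p^M ≢ 0 (4)`: ALL ODD `p`, `a_p = 0`) is a
FREE `ℤ_p[H]`-module — a direct sum of copies of the induced module `Ind_1^H V`, `V = ℤ_p[Γ_m]/(ω_m^±)`.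
Section `InducedModel` checks the cohomological triviality that the descent uses, in the model
`Ind_1^H V = (H → V)` with `(h·f)(x) = f(h⁻¹x)`: `invariant_iff_const` (`(Ind V)^H` = constants ≅ `V`),
`sum_shift_eq_norm` (the norm `Σ_h h·f` is the constant `Σ_x f x`), `norm_single_one` (every invariant is
a norm: `Ĥ⁰ = 0`), `exists_aug_of_sum_eq_zero` (a norm-zero element is a sum of `h·g - g`: `Ĥ⁻¹ = 0`).
Hence `(N^±)^H ≅ (N^±)_H = ℤ_p[Gal(F/ℚ_p)]/(ω_m^±(γ_F - 1))` — and `(N^±)^H = Ê^±(𝔪_F)` EXACTLY, because the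
formal trace `tr_{k_{m,M}/k_{ℓ+1,M}}` restricts to `tr_{F/F_{ℓ+1}}` on `Ê(𝔪_F)` (`H ∩ Γ_m = 1`) and
`Ê(𝔪_{F_{ℓ+1}}) ∩ Ê(𝔪_{k_{ℓ,M}}) = Ê(𝔪_{F_ℓ})` (coordinates): the anticyclotomic-parity signed subgroups of
Hatley–Lei–Vigni / Castella–Wan are the `H`-invariants of the cyclotomic-parity two-variable ones
(CW p. 12: «we easily see»). So P⁺ is ANSWERED: cyclic presentation with exact annihilator `ω_m^±` over
`F` and over every unramified `3`-power thickening `k^s·F` (the completions of the pro-`3` ring-class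
tower of g71), BOTH signs, `p = 3` included — no port of the even-level argument to the relative
Lubin–Tate tower and no `p > 3` source (Kim 2007/2014) is needed at finite level.
No `sorry`, no new axioms, Mathlib only.
-/

open Finset

namespace Summit.BirchSwinnertonDyer.BirchSwinnertonDyer.Cruxes.TwinAlgMuZeroAtThree.OnePointSqueeze.UnramifiedDescent

section Bookkeeping

/-- The one divisibility behind everything: `m + a ≤ M` and `p^M ∣ j·p^a` force `p^m ∣ j`. -/
theorem pow_dvd_of_pow_dvd_mul_pow {p : ℕ} (hp : 0 < p) {M m a j : ℕ} (hM : m + a ≤ M)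
    (h : p ^ M ∣ j * p ^ a) : p ^ m ∣ j := by
  have h1 : p ^ m * p ^ a ∣ j * p ^ a := by
    rw [← pow_add]
    exact (pow_dvd_pow p hM).trans h
  exact Nat.dvd_of_mul_dvd_mul_right (pow_pos hp a) h1

/-- `F ⊆ k_{m,M}` (1): in `𝒢 = ℤ²` (a fortiori in `ℤ_p²`), `p^m·γ ∈ ℤ·(γ - p^a u) + p^{a+m}𝒢`.
Coordinates `(u, γ)`. -/
theorem layer_le_twoVariable₁ (p : ℤ) (a m : ℕ) :
    ∃ c : ℤ, ∃ v : ℤ × ℤ, ((0 : ℤ), p ^ m) = c • (-(p ^ a), (1 : ℤ)) + (p ^ (a + m)) • v := by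
  refine ⟨p ^ m, ((1 : ℤ), 0), ?_⟩
  ext <;> (simp; try ring)

/-- `F ⊆ k_{m,M}` (2): `p^M·u ∈ p^{a+m}𝒢` as soon as `a + m ≤ M`. -/
theorem layer_le_twoVariable₂ (p : ℤ) {a m M : ℕ} (hM : a + m ≤ M) :
    ∃ v : ℤ × ℤ, ((p ^ M : ℤ), (0 : ℤ)) = (p ^ (a + m)) • v := by
  refine ⟨(p ^ (M - (a + m)), 0), ?_⟩
  ext <;> simp [← pow_add, Nat.add_sub_cancel' hM]

variable (p M m a : ℕ)

/-- The generator of `H = Gal(k_{m,M}/F)` inside `U_M × Γ_m = ℤ/p^M × ℤ/p^m`: `h = (u^{-p^a}, γ)`,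
written additively. -/
def hGen : ZMod (p ^ M) × ZMod (p ^ m) := (-((p ^ a : ℕ) : ZMod (p ^ M)), 1)

theorem nsmul_hGen (j : ℕ) :
    j • hGen p M m a = (-((j * p ^ a : ℕ) : ZMod (p ^ M)), ((j : ℕ) : ZMod (p ^ m))) := by
  ext <;> simp [hGen, smul_neg, nsmul_eq_mul]

variable {p M m a}

/-- `j • h = 0 ↔ p^{M-a} ∣ j` (so `#H = p^{M-a}`), for `m + a ≤ M`, `p > 0`. -/
theorem nsmul_h_eq_zero_iff (hp : 0 < p) (hM : m + a ≤ M) (j : ℕ) :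
    j • hGen p M m a = 0 ↔ p ^ (M - a) ∣ j := by
  have hpM : NeZero (p ^ M) := ⟨(pow_pos hp M).ne'⟩
  have hpm : NeZero (p ^ m) := ⟨(pow_pos hp m).ne'⟩
  rw [nsmul_hGen, Prod.mk_eq_zero, neg_eq_zero, ZMod.natCast_eq_zero_iff,
    ZMod.natCast_eq_zero_iff]
  have haM : a ≤ M := by omega
  constructor
  · rintro ⟨h1, -⟩
    have : p ^ (M - a) * p ^ a ∣ j * p ^ a := by
      rw [← pow_add, Nat.sub_add_cancel haM]; exact h1
    exact Nat.dvd_of_mul_dvd_mul_right (pow_pos hp a) this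
  · intro h
    refine ⟨?_, ?_⟩
    · have : p ^ M = p ^ (M - a) * p ^ a := by rw [← pow_add, Nat.sub_add_cancel haM]
      rw [this]; exact Nat.mul_dvd_mul_right h (p ^ a)
    · exact (pow_dvd_pow p (by omega : m ≤ M - a)).trans h

/-- The order of `h` is `p^{M-a}`: `[k_{m,M} : F] = p^{M-a}`. -/
theorem addOrderOf_hGen (hp : 0 < p) (hM : m + a ≤ M) :
    addOrderOf (hGen p M m a) = p ^ (M - a) := by
  apply Nat.dvd_antisymm
  · exact addOrderOf_dvd_of_nsmul_eq_zero ((nsmul_h_eq_zero_iff hp hM _).2 dvd_rfl)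
  · exact (nsmul_h_eq_zero_iff hp hM _).1 (addOrderOf_nsmul_eq_zero _)

/-- UNRAMIFIED: `H` meets the inertia axis `Γ_m = {0} × ℤ/p^m` trivially — an element of `H` with
trivial `U`-component is trivial. -/
theorem inertia_meets_H_trivially (hp : 0 < p) (hM : m + a ≤ M) (j : ℕ)
    (hj : (j • hGen p M m a).1 = 0) : j • hGen p M m a = 0 := by
  have hpM : NeZero (p ^ M) := ⟨(pow_pos hp M).ne'⟩
  rw [nsmul_hGen] at hj
  simp only [neg_eq_zero, ZMod.natCast_eq_zero_iff] at hj
  rw [nsmul_h_eq_zero_iff hp hM]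
  have haM : a ≤ M := by omega
  have : p ^ (M - a) * p ^ a ∣ j * p ^ a := by
    rw [← pow_add, Nat.sub_add_cancel haM]; exact hj
  exact Nat.dvd_of_mul_dvd_mul_right (pow_pos hp a) this

/-- FREE ACTION on the unramified index: if `j•h` fixes some `x ∈ U_M = ℤ/p^M` under translation by
its `U`-component, then `j•h = 1`.  So `ℤ_p[U_M] ⊗ V` is a free `ℤ_p[H]`-module (sum of `Ind_1^H V`). -/
theorem H_acts_freely_on_unramified_index (hp : 0 < p) (hM : m + a ≤ M) (j : ℕ) (x : ZMod (p ^ M))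
    (hx : x + (j • hGen p M m a).1 = x) : j • hGen p M m a = 0 :=
  inertia_meets_H_trivially hp hM j (by simpa using hx)

/-- The thickening `F^{(s)} = k^s · F` (`a ≤ s ≤ M`): `H_s = Gal(k_{m,M}/F^{(s)}) = H ∩ (p^s U_M × Γ_m)`;
membership `j•h ∈ p^s U_M × Γ_m ↔ p^{s-a} ∣ j`, so `H_s = ⟨p^{s-a} • h⟩ ≤ H` and the two lemmas above
apply to `H_s` verbatim. -/
theorem nsmul_h_fst_mem_iff (hp : 0 < p) {s : ℕ} (has : a ≤ s) (hsM : s ≤ M) (j : ℕ) :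
    (∃ y : ℕ, (j • hGen p M m a).1 = -((y * p ^ s : ℕ) : ZMod (p ^ M))) ↔ p ^ (s - a) ∣ j := by
  have hpM : NeZero (p ^ M) := ⟨(pow_pos hp M).ne'⟩
  rw [nsmul_hGen]
  simp only [neg_inj]
  constructor
  · rintro ⟨y, hy⟩
    rw [ZMod.natCast_eq_natCast_iff'] at hy
    -- `j p^a ≡ y p^s (mod p^M)` with `s ≤ M` gives `p^s ∣ j p^a`, hence `p^{s-a} ∣ j`.
    have h1 : p ^ s ∣ j * p ^ a := by
      have hmod := (Nat.ModEq.comm.mp hy)  -- y*p^s ≡ j*p^a [MOD p^M]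
      have hd : p ^ s ∣ p ^ M := pow_dvd_pow p hsM
      have := (Nat.ModEq.of_dvd hd hmod)   -- y*p^s ≡ j*p^a [MOD p^s]
      have h0 : y * p ^ s ≡ 0 [MOD p ^ s] := (Nat.dvd_mul_left _ _).modEq_zero_nat
      exact (Nat.modEq_zero_iff_dvd.mp (this.symm.trans h0))
    have : p ^ (s - a) * p ^ a ∣ j * p ^ a := by
      rw [← pow_add, Nat.sub_add_cancel has]; exact h1
    exact Nat.dvd_of_mul_dvd_mul_right (pow_pos hp a) this
  · rintro ⟨c, rfl⟩
    refine ⟨c, ?_⟩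
    congr 1
    rw [mul_comm (p ^ (s - a)) c, mul_assoc, ← pow_add, Nat.sub_add_cancel has]

/-- Numerical instance at `p = 3` (the card's kill shape `d = 3`, i.e. `a = 1`, first `+` level `m = 2`,
`M = m + a = 3`): `#H = 9 = [k_{2,3} : F]`, and `H ∩ Γ_2 = 1`. -/
example : addOrderOf (hGen 3 3 2 1) = 9 := by
  rw [addOrderOf_hGen (p := 3) (M := 3) (m := 2) (a := 1) (by norm_num) (by norm_num)]; norm_num

example : ∀ j < 27, (j • hGen 3 3 2 1).1 = 0 → j • hGen 3 3 2 1 = 0 := by decide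

end Bookkeeping

section InducedModel

/-! ### The induced module `Ind_1^H V = (H → V)` is cohomologically trivial (`Ĥ⁰ = Ĥ⁻¹ = 0`)
and its invariants are `V`.  This is the algebra of the descent `(N^±)^H ≅ (N^±)_H`. -/

variable {H : Type*} [Group H] {V : Type*} [AddCommGroup V]

/-- The left-regular action on functions: `(h·f)(x) = f(h⁻¹x)`. -/
def shift (h : H) (f : H → V) : H → V := fun x => f (h⁻¹ * x)

@[simp] theorem shift_apply (h : H) (f : H → V) (x : H) : shift h f x = f (h⁻¹ * x) := rfl

theorem shift_one (f : H → V) : shift (1 : H) f = f := by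
  funext x; simp

theorem shift_mul (g h : H) (f : H → V) : shift (g * h) f = shift g (shift h f) := by
  funext x; simp [mul_assoc]

theorem shift_add (h : H) (f g : H → V) : shift h (f + g) = shift h f + shift h g := rfl

/-- `(Ind V)^H` = the constant functions (≅ `V`). -/
theorem invariant_iff_const (f : H → V) : (∀ h : H, shift h f = f) ↔ ∃ v : V, ∀ x, f x = v := by
  constructor
  · intro hf
    refine ⟨f 1, fun x => ?_⟩
    have := congrFun (hf x) x
    simpa using this.symm
  · rintro ⟨v, hv⟩ h
    funext x
    simp [hv]

variable [Fintype H] [DecidableEq H]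

/-- The norm `Σ_h h·f` is the constant function `x ↦ Σ_y f y`. -/
theorem sum_shift_eq_norm (f : H → V) (x : H) : (∑ h, shift h f x) = ∑ y, f y := by
  simp only [shift_apply]
  exact Fintype.sum_equiv ((Equiv.inv H).trans (Equiv.mulRight x)) _ _ (fun h => by simp)

/-- `Ĥ⁰(H, Ind V) = 0`: every invariant (= constant `v`) is a norm, namely of `δ_1 ⊗ v`. -/
theorem norm_single_one (v : V) (x : H) : (∑ h, shift h (Pi.single (1 : H) v) x) = v := by
  rw [sum_shift_eq_norm]
  exact Fintype.sum_pi_single' 1 v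

/-- `h · (δ_1 ⊗ v) = δ_h ⊗ v`. -/
theorem shift_single_one (h : H) (v : V) : shift h (Pi.single (1 : H) v) = Pi.single h v := by
  funext x
  by_cases hx : x = h
  · subst hx; simp
  · simp [hx, Ne.symm hx, inv_mul_eq_one]

/-- `Ĥ⁻¹(H, Ind V) = 0`: an element of norm zero is a sum of `h·g_h - g_h` (lies in the augmentation
submodule `I_H · Ind V`). Explicitly `g_h = δ_1 ⊗ f(h)`. -/
theorem exists_aug_of_sum_eq_zero (f : H → V) (hf : ∑ y, f y = 0) :
    f = ∑ h, (shift h (Pi.single (1 : H) (f h)) - Pi.single (1 : H) (f h)) := by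
  have h1 : ∀ x, (∑ h, (Pi.single h (f h) : H → V) x) = f x := fun x => Fintype.sum_pi_single x f
  have h2 : ∀ x, (∑ h, (Pi.single (1 : H) (f h) : H → V) x) = 0 := fun x => by
    by_cases hx : x = 1
    · subst hx; simp only [Pi.single_eq_same]; exact hf
    · simp only [Pi.single_eq_of_ne hx, Finset.sum_const_zero]
  funext x
  simp only [shift_single_one, Finset.sum_apply, Pi.sub_apply, Finset.sum_sub_distrib, h1, h2,
    sub_zero]

/-- Summary in the shape the descent uses: for `f ∈ Ind_1^H V`, `f` is `H`-invariant iff it is the norm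
of `δ_1 ⊗ f(1)` — so the norm map induces `(Ind V)_H ≅ (Ind V)^H ≅ V`. -/
theorem invariant_iff_eq_norm (f : H → V) :
    (∀ h : H, shift h f = f) ↔ f = fun x => ∑ h, shift h (Pi.single (1 : H) (f 1)) x := by
  rw [invariant_iff_const]
  constructor
  · rintro ⟨v, hv⟩
    funext x
    rw [norm_single_one, hv x, hv 1]
  · intro hf
    refine ⟨f 1, fun x => ?_⟩
    have := congrFun hf x
    rw [norm_single_one] at this
    exact this

end InducedModel

end Summit.BirchSwinnertonDyer.BirchSwinnertonDyer.Cruxes.TwinAlgMuZeroAtThree.OnePointSqueeze.UnramifiedDescent
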